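import Literature.MathematicalPhysics.QuantumFieldTheory.Balaban1983to89.B15Claim189AtInstances
import Literature.MathematicalPhysics.QuantumFieldTheory.Balaban1983to89.B15RPrime1100AtRecord

/-!
# `Balaban1983to89.B15Claim189PinAtRecord` — YM-DAG node N12 · [Balaban1989LargeFieldI] CMP **122** (1989) 175–202, (1.89) p. 198 (with (1.75), (1.80), (1.88),
# (1.21)∕(1.24)) at NODE 00's records with the [IV] bundle pinned: THE (1.89) LETTERS OF THE RESIDUAL [IV] LAYER `ResidW.D189` PINNED to r11's PRINT'S-INSTANCE
# setting `B15Claim189AtInstances.setting189Std` READ AT NODE 00's OBJECTS — def-R's (2.12) solution map of record `bgOfRecord`, the layer width `M₁` and the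
# thresholds `ε_j = epsOfRecord` of the record's numerics, the fine lattice `F.P P.K` (so `L`, `η`), def-R's cube geometry `plaqInside ∘ cubeEnl` — leaving
# RESIDUAL only the per-run (1.89) SITUATION (`Node00.Sit189`: levels, regions, numbers, cube finsets, the (1.82) chart letter, p29's deviation letters); at a
# pinned layer the remaining functions of (1.89) ARE r11's concrete [III] (2.17) ∕ (1.75) ∕ (1.88) functions and the dropped `χ″_k` IS r11's concrete (1.24)
# function of `U″_{k,Z}(V)` built from def-R's background (r11's junctions BY NAME)

statement-level bookkeeping over published theorems with citation tags; kernel-checked compositions of tree theorems; nothing here is a claim about the Yang–Mills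
mass gap.

CITATION HEADER (lean-in-tree rule).  Source: [Balaban1989LargeFieldI] («[IV]»): (1.89) p. 198 (*"with the new functions introduced in the integral, we can drop
the function χ″_k"*; *"The equality χ_h(Ω_h∩Z_h) = 1 is immediate, so we have to prove that χ″_k = 1"*), pp. 199–200, (1.75) p. 193, (1.80) p. 195, (1.88) p. 198,
(1.21) p. 181, (1.24) pp. 181–182; [Balaban1988Convergent] (2.12) p. 256, (2.16)–(2.17) p. 257 (the backgrounds and cube functions).  Seat `pub-ymgap-dag-n12-e`
(YM-PLAN Track A, HUMAN RULING D-0062; director-ym R134 row N12 s3 «the (1.80)∕(1.89) + 𝐑′ (1.99)–(1.100) p. 201 chain»), module 4 — the D189 pin, companion of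
module 2's D1100 pin `ResidW.pinRPrime`.  BY NAME and UNCHANGED: r11's `B15Claim189AtInstances` (`setting189Std`, `new189_iff`, `chiH_iff`, `chiPP_iff`,
`eq189_at_instances`), p29's `B15Claim189Assembly` (`Setting189`, `new189`, `chiPP`, `claim189_assembly_of_flow`), r11's `B15Sect1Instances` (`bgPPZstd`, `chi175std`,
`chi124std`), `B15Eq13Concrete` (`chiHalf`, `chi13`, `oneOn`), `B14.Eq216Concrete` (`chi217`, `ukBox`), def-R's `Node00.SmallFieldChiOfRecord` (`bgOfRecord`, `cubeEnl`,
`plaqInside`, `epsOfRecord`), `Node00.DatumAvLayer` (`avOfRecord`), node00-def g30's `Node00.CarriersW` (`ResidW`, `WDisplays₁₀`, `WOfRecord₁₀`), module 2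
`B15RPrime1100AtRecord` (`ResidW.pinRPrime`, `wDisplays₁₀_of_rPrimePin_leaves189`).

WHY THIS FILE.  After modules 1–3 the [IV] displays at a layer with pinned (1.100) data are: positive mass, Proposition 1 (1.78) on `λ.LF P`, and (1.80) + (1.89) (or
(1.89)'s printed leaves) on the (1.89) letters `λ.D189 P : Setting189 (P₀ P) (SU N) (Cfg P) (ι P)` — ALL RESIDUAL: the N12 s2 seat's `exists_residW_printedDisplays`
satisfies them by junk (`χ_k(Ω_k^{∼4}) :≡ ⊥`).  The dossier's identification for the (1.89) row (n12-a `N12-DOSSIER.md` §6: «`D189`'s letters = r11's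
`setting189Std bg M₁ …` with `bg` ↔ def-R's `bgOfRecord`») is typed here as a DATA TRANSFORMER `ResidW.pinD189 λ θ σ`: the background, `M₁`, `ε`, the lattice and the
cube geometry are THE RECORD'S; the situation `σ P : Sit189 F N P.K` stays residual.  Then r11's junctions apply verbatim: `new189` at the pin ⟺ [III] (2.17)
`chi217 (bgOfRecord …) … = 1` ∧ (1.75) `chi175std (bgOfRecord …) …` ∧ (1.88) `chiHalf (bgOfRecord …) … = 1` ∧ χ′; `chiPP` at the pin ⟺ (1.24) `chi124std (bgOfRecord …) …
(k − h)` — the conclusion of (1.89) is a statement about def-R's background `U″_{k,Z}(V) = bgPPZstd (bgOfRecord …) …`, no longer a free predicate.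

WHAT THIS FILE PROVES (0 `sorry`; one structure `Node00.Sit189` (data), two small defs `D189OfRecord`, `Node00.ResidW.pinD189`).
§1 `Node00.Sit189` (+ A2 `Node00.nonempty_sit189`), `D189OfRecord` + `rfl` ∕ `Iff.rfl` field lemmas (`_ε ∕ _L ∕ _η ∕ _levels ∕ _Upp ∕ _Uhalf ∕ _chiΛ ∕ _chiΩ4`).
§2 `Node00.ResidW.pinD189` + `rfl` lemmas (`pinD189_kSel ∕ _LF ∕ _D1100 ∕ _D189`, `pinD189_pinRPrime_comm`, `pinRPrime_pinD189_D189`).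
§3 r11's junctions AT THE PIN: **`new189_D189OfRecord_iff`**, `chiH_D189OfRecord_iff`, **`chiPP_D189OfRecord_iff`**, **`eq189_D189OfRecord`** ((1.89) at the record's objects:
   `Claim189` at the pin + the four concrete remaining functions ⇒ r11's concrete `χ″_k` at def-R's background).
§4 **`wDisplays₁₀_pinD189_of_rPrimePin_leaves`** (the [IV] displays at a D189-pinned layer with the (1.100) pin equation ⇐ `Provisos₁₀` + `kSel P < P.K` + mass + Prop. 1 +
   (1.80) on `σ.dev0` + (1.89)'s printed leaves AT THE RECORD'S OBJECTS — p29's `claim189_assembly_of_flow` through module 2's `wDisplays₁₀_of_rPrimePin_leaves189`, with the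
   torus's `L`, `η_k` and the record's `ε_j`), `wDisplays₁₀_pinD189_of_rPrimePin` (same with (1.89) kept as ONE display at the pinned letters); A2 `exists_residW_pinD189_pinRPrime`
   (doubly pinned layers exist).

LOCATED (for node00-def ∕ def-R to rule; nothing below is asserted): (i) ONE (1.89) situation per run — the W pin's own granularity (`PrintedCarriers15` is one basic step;
n12-a's located question «which step ∕ which term per run» is unchanged); (ii) the regularity class of the background is def-R's LEVEL-`σ.k` class
`{U | PlaqSmall (εreg·η_k²) U}` (as `chiSeqOfRecord … k`), used for all levels `h…k` of the situation (def-R's `χ` of record reads a level-dependent class); (iii) the cube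
sides `σ.sh ∕ σ.sk` are situation numbers whose INTENDED values are `cubeSide (F.P P.K).L θ.ν.M₂ (RkOfRecord (F.P P.K).L θ.ν.r (g h)) h` resp. `… k` — NOT enforced: typing the
cube-index carrier as `↥(cubeIndices (F.P K) (cubeSide …))` exhausts the default heartbeats at `structure` elaboration (kernel note; cf. `Record11Carriers` LESSON 7), so the index
carrier is `B14DomainGeom.Pt (F.P K).d` and the families are def-R's `cubeEnl ∕ plaqInside` at the stated sides; (iv) the deviations `devV″ ∕ dev97 ∕ dev0` of the intermediate
configurations (1.90) ∕ (1.97) ∕ `U₀^{ū₀}` stay LETTERS (p29's HONEST SCOPE (ii): no tree construction) — so (1.80) and the leaves `L91h ∕ L95 ∕ L91 ∕ L97` remain displays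
about residual functions of `V`.

HONEST FRAMING.  Count-neutral: one data transformer + r11 ∕ p29 junctions by name; NO estimate; nothing of Bałaban's asserted; N12 NOT discharged; one finite four-torus
programme at fixed `ε`, Bałaban AS PRINTED with locators; nothing continuum ∕ ℝ⁴ ∕ OS ∕ mass gap ∕ Clay.  No `sorry`, no `axiom`, no `instance`, no `notation`.
-/

noncomputable section

open scoped BigOperators
open MeasureTheory

namespace Literature.MathematicalPhysics.QuantumFieldTheory.Balaban1983to89

/-! ## §1. The per-run (1.89) SITUATION (residual data) and the (1.89) letters READ AT NODE 00's objects -/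

namespace Node00

/-- **THE (1.89) SITUATION on the torus `K`** — the data of ONE instance of (1.89) that the record does NOT determine (residual, no law): the chart variable's carrier `𝔤`
and the (1.82) letter `chiP`; the levels `h ≤ k₀ ≤ k` of (1.24) ∕ (1.89); the cube sides `sh ∕ sk` (fine sites) of the `LM₂R_h`- ∕ `LM₂R_k`-partitions (INTENDED: def-R's
`cubeSide …`, located note (iii)); the regions `Ω_j`, `Z″_j`, `Z`, `Λ`, `Ω″^∼_{h+1}`, `Ω″^{∼2}_{h+1}`; print's numbers `β, L₀, α, δ, B₃, B₅, M` and the `O(1)` of (1.80); `dist(p, Λ)`;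
the cube families of `χ_{h,1/2}` ∕ `χ_h(Ω_h∩Z_h)` ∕ `χ_k(Ω_k^{∼4})` and the cube `□ ∋ p` used per plaquette; p29's deviation letters of the configurations (1.90), (1.97), `U₀^{ū₀}`.
[cite: Balaban1989LargeFieldI, (1.89) p.198, pp.199–200, (1.24) pp.181–182, (1.82) p.196 (the data the typed statements read)] -/
structure Sit189 (F : T4Continuum.T4Family) (N : ℕ) [NeZero N] (K : ℕ) where
  /-- carrier of the (1.82) chart variable `B′` (letter) -/
  𝔤 : Type
  /-- the (1.82) function `χ′` as a letter on `B′` -/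
  chiP : ((j : ℕ) → VecField (F.P K) j 𝔤) → Prop
  /-- the levels `h`, `k₀ = k − N₀`, `k` -/
  h : ℕ
  k₀ : ℕ
  k : ℕ
  /-- cube sides (fine sites) of the `LM₂R_h`- and `LM₂R_k`-partitions -/
  sh : ℕ
  sk : ℕ
  /-- the regions -/
  Ω : ℕ → Set (Site (F.P K) 0)
  Zpp : ℕ → Set (Site (F.P K) 0)
  Z : Set (Site (F.P K) 0)
  Λ : Set (Site (F.P K) 0)
  OmT : Set (Site (F.P K) 0)
  ΩppT2 : Set (Site (F.P K) 0)
  /-- print's numbers -/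
  β : ℝ
  L₀ : ℝ
  α : ℝ
  δ : ℝ
  B₃ : ℝ
  B₅ : ℝ
  M : ℝ
  O1 : ℝ
  /-- `dist(p, Λ)` -/
  dist : Plaq (F.P K) 0 → ℝ
  /-- cube families and the cube of a plaquette -/
  Xhalf : Finset (B14DomainGeom.Pt (F.P K).d)
  XH : Finset (B14DomainGeom.Pt (F.P K).d)
  XΩ4 : Finset (B14DomainGeom.Pt (F.P K).d)
  boxOf : Plaq (F.P K) 0 → B14DomainGeom.Pt (F.P K).d
  /-- p29's deviation letters -/
  devV'' : B15DeterminingSets.MSField (F.P K) (SU N) → Plaq (F.P K) 0 → ℝ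
  dev97 : B15DeterminingSets.MSField (F.P K) (SU N) → Plaq (F.P K) 0 → ℝ
  dev0 : B15DeterminingSets.MSField (F.P K) (SU N) → Plaq (F.P K) 0 → ℝ

/-- **A2 — the situation type is inhabited** (DEGENERATE inhabitant: trivial chart carrier, levels `0`, empty regions and cube families, all numbers `0`, zero deviation
letters; NOT objects of record): so the D189 pin of `ResidW` below never empties a record class. [cite: Balaban1989LargeFieldI, (1.89) p.198 (bookkeeping witness)] -/
theorem nonempty_sit189 (F : T4Continuum.T4Family) (N : ℕ) [NeZero N] (K : ℕ) : Nonempty (Sit189 F N K) :=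
  ⟨{ 𝔤 := PUnit, chiP := fun _ => True, h := 0, k₀ := 0, k := 0, sh := 0, sk := 0, Ω := fun _ => ∅, Zpp := fun _ => ∅, Z := ∅, Λ := ∅, OmT := ∅, ΩppT2 := ∅,
     β := 0, L₀ := 0, α := 0, δ := 0, B₃ := 0, B₅ := 0, M := 0, O1 := 0, dist := fun _ => 0, Xhalf := ∅, XH := ∅, XΩ4 := ∅, boxOf := fun _ _ => 0,
     devV'' := fun _ _ => 0, dev97 := fun _ _ => 0, dev0 := fun _ _ => 0 }⟩

end Node00

namespace B15Claim189PinAtRecord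

open DagBinding T4Continuum Node00
open B15 (Prop1Printed Ineq180)
open B15.BasicStep (fibreIntegral Claim189)
open B15.PrelimIntegrations (Ineq191 Ineq195)
open B15Chi124DetSets (E124)
open B15DeterminingSets (MSField DetBackground)
open B14.Eq216Concrete (chi217 ukBox)
open B15Eq13Concrete (chiHalf chi13 oneOn)
open B15Sect1Instances (bgPPZstd chi175std chi124std)
open B15Claim189Assembly (Setting189 new189 chiH chiPP dropped189 dom domK half X claim189_assembly_of_flow)
open B15Claim189AtInstances (setting189Std)
open B8Eq17ClassAkV1 (plaqsOf)
open GaugeGroup (dist1)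
open GaugeField (plaqHol)
open B15RPrime1100OfRep (rPrimeDataOfSel)
open B15RPrime1100AtRecord (wDisplays₁₀_of_rPrimePin_leaves189)

variable {F : T4Family} {N : ℕ} [NeZero N]

section Letters

variable (θ : Stage9Params F N) (P : B12.RunParams) (σ : Sit189 F N P.K)

/-- **THE (1.89) LETTERS OF RECORD at `(θ, P, σ)`**: r11's print's-instance setting `setting189Std` READ AT def-R's (2.12) solution map of record (regularity class at level
`σ.k`), `M₁ := θ.ν.M₁`, def-R's cube geometry at sides `σ.sh ∕ σ.sk`, the thresholds `ε_j := epsOfRecord θ.ν (gOfRecord₁₀ θ P) j`, the fine lattice `F.P P.K`, and the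
situation `σ`. [cite: Balaban1989LargeFieldI, (1.89) p.198, (1.21) p.181, (1.75) p.193, (1.88) p.198; Balaban1988Convergent, (2.12) p.256, (2.16)–(2.17) p.257 (objects of record)] -/
def D189OfRecord : Setting189 (F.P P.K) (SU N) (MSField (F.P P.K) (SU N) × ((j : ℕ) → VecField (F.P P.K) j σ.𝔤)) (B14DomainGeom.Pt (F.P P.K).d) :=
  setting189Std (bgOfRecord (avOfRecord F N P.K) {U | PlaqSmall (θ.ν.εreg * (F.P P.K).eta σ.k ^ 2) U}) θ.ν.M₁
    (fun a => plaqInside (cubeEnl (F.P P.K) σ.sh a 1)) (fun a => cubeEnl (F.P P.K) σ.sh a 4)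
    (fun a => plaqInside (cubeEnl (F.P P.K) σ.sk a 1)) (fun a => cubeEnl (F.P P.K) σ.sk a 4) σ.XΩ4
    σ.Ω σ.Zpp σ.Z σ.Λ σ.OmT σ.ΩppT2 σ.h σ.k₀ σ.k σ.β σ.L₀ σ.α σ.δ σ.B₃ σ.B₅ σ.M σ.O1 (epsOfRecord θ.ν (gOfRecord₁₀ F N θ P)) σ.dist σ.Xhalf σ.XH σ.boxOf
    σ.chiP σ.devV'' σ.dev97 σ.dev0

/-- Its thresholds ARE the record's `ε_j` (`rfl`). [cite: Balaban1988Convergent, (2.4) p.255 (bookkeeping)] -/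
theorem D189OfRecord_ε : (D189OfRecord θ P σ).ε = epsOfRecord θ.ν (gOfRecord₁₀ F N θ P) := rfl

/-- Its `L` IS the torus's (`rfl`). [cite: Balaban1989LargeFieldI, p.199 (bookkeeping)] -/
theorem D189OfRecord_L : (D189OfRecord θ P σ).L = ((F.P P.K).L : ℝ) := rfl

/-- Its `η` IS `η_k` of the torus (`rfl`). [cite: Balaban1989LargeFieldI, p.199 (bookkeeping)] -/
theorem D189OfRecord_η : (D189OfRecord θ P σ).η = (F.P P.K).eta σ.k := rfl

/-- Its levels are the situation's (`rfl` ×3). [cite: Balaban1989LargeFieldI, (1.24) p.181 (bookkeeping)] -/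
theorem D189OfRecord_levels : (D189OfRecord θ P σ).h = σ.h ∧ (D189OfRecord θ P σ).k₀ = σ.k₀ ∧ (D189OfRecord θ P σ).k = σ.k := ⟨rfl, rfl, rfl⟩

/-- Its `U″_{k,Z}` IS r11's (1.21) background at def-R's solution map of record (`rfl`). [cite: Balaban1989LargeFieldI, (1.21) p.181; Balaban1988Convergent, (2.12) p.256] -/
theorem D189OfRecord_Upp (U : MSField (F.P P.K) (SU N) × ((j : ℕ) → VecField (F.P P.K) j σ.𝔤)) :
    (D189OfRecord θ P σ).Upp U
      = bgPPZstd (bgOfRecord (avOfRecord F N P.K) {U | PlaqSmall (θ.ν.εreg * (F.P P.K).eta σ.k ^ 2) U}) θ.ν.M₁ σ.Ω σ.Zpp σ.Z σ.h σ.k U.1 := rfl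

/-- Its `U_{h,□}((1, V_h))` IS r11's [III] (2.16) `ukBox` at def-R's map, on def-R's `□^{∼4}` (`rfl`). [cite: Balaban1988Convergent, (2.16) p.257; Balaban1989LargeFieldI, (1.88) p.198] -/
theorem D189OfRecord_Uhalf (U : MSField (F.P P.K) (SU N) × ((j : ℕ) → VecField (F.P P.K) j σ.𝔤)) (c : B14DomainGeom.Pt (F.P P.K).d) :
    (D189OfRecord θ P σ).Uhalf U c
      = ukBox (bgOfRecord (avOfRecord F N P.K) {U | PlaqSmall (θ.ν.εreg * (F.P P.K).eta σ.k ^ 2) U}) θ.ν.M₁ (cubeEnl (F.P P.K) σ.sh c 4) σ.h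
          (oneOn σ.ΩppT2 σ.h (U.1 σ.h)) := rfl

/-- Its `χ_{k,Λ}` IS r11's (1.75) `chi175std` at def-R's map with the record's `ε_k`, `η_k` (`Iff.rfl`). [cite: Balaban1989LargeFieldI, (1.75) p.193] -/
theorem D189OfRecord_chiΛ (U : MSField (F.P P.K) (SU N) × ((j : ℕ) → VecField (F.P P.K) j σ.𝔤)) :
    (D189OfRecord θ P σ).chiΛ U ↔
      chi175std (bgOfRecord (avOfRecord F N P.K) {U | PlaqSmall (θ.ν.εreg * (F.P P.K).eta σ.k ^ 2) U}) θ.ν.M₁ σ.Z σ.Λ σ.k σ.Ω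
        (epsOfRecord θ.ν (gOfRecord₁₀ F N θ P) σ.k) ((F.P P.K).eta σ.k) (U.1 σ.k) := Iff.rfl

/-- Its `χ_k(Ω_k^{∼4})` IS r11's [III] (2.17) `chi217 … = 1` at def-R's map and cube geometry (`Iff.rfl`). [cite: Balaban1988Convergent, (2.17) p.257; Balaban1989LargeFieldI, (1.89) p.198] -/
theorem D189OfRecord_chiΩ4 (U : MSField (F.P P.K) (SU N) × ((j : ℕ) → VecField (F.P P.K) j σ.𝔤)) :
    (D189OfRecord θ P σ).chiΩ4 U ↔
      chi217 (bgOfRecord (avOfRecord F N P.K) {U | PlaqSmall (θ.ν.εreg * (F.P P.K).eta σ.k ^ 2) U}) θ.ν.M₁ σ.XΩ4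
        (fun a => plaqInside (cubeEnl (F.P P.K) σ.sk a 1)) (fun a => cubeEnl (F.P P.K) σ.sk a 4) (epsOfRecord θ.ν (gOfRecord₁₀ F N θ P) σ.k) σ.k (U.1 σ.k) = 1 :=
  Iff.rfl

end Letters

/-! ## §2. The residual [IV] layer with the (1.89) letters PINNED to the record's objects -/

section Pin

variable (θ : Stage9Params F N) (lam : ResidW F N) (σ : ∀ P : B12.RunParams, Sit189 F N P.K)

/-- **THE D189-PINNED RESIDUAL LAYER**: `λ` with, per run, the (1.89) configuration carrier := `(V, B′)` on the fine lattice `F.P P.K`, the cube-index carrier := def-R's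
`Pt (F.P P.K).d`, and the (1.89) letters := `D189OfRecord θ P (σ P)`; `kSel`, the Proposition-1 carrier and the (1.100) data unchanged.  A function of the record's
parameters `θ` and the residual situations `σ` — data, no law. [cite: Balaban1989LargeFieldI, (1.89) p.198 (objects of record)] -/
def _root_.Literature.MathematicalPhysics.QuantumFieldTheory.Balaban1983to89.Node00.ResidW.pinD189 (lam : ResidW F N) (θ : Stage9Params F N)
    (σ : ∀ P : B12.RunParams, Sit189 F N P.K) : ResidW F N :=
  { lam with
    P₀ := fun P => F.P P.K
    Cfg := fun P => MSField (F.P P.K) (SU N) × ((j : ℕ) → VecField (F.P P.K) j (σ P).𝔤)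
    ι := fun P => B14DomainGeom.Pt (F.P P.K).d
    D189 := fun P => D189OfRecord θ P (σ P) }

/-- The pin keeps the step selector (`rfl`). [cite: Balaban1989LargeFieldI, (0.2) p.176 (bookkeeping)] -/
theorem pinD189_kSel : (lam.pinD189 θ σ).kSel = lam.kSel := rfl

/-- The pin keeps the Proposition-1 carrier (`rfl`). [cite: Balaban1989LargeFieldI, Prop. 1 p.194 (bookkeeping)] -/
theorem pinD189_LF : (lam.pinD189 θ σ).LF = lam.LF := rfl

/-- The pin keeps the (1.100) data (`rfl`). [cite: Balaban1989LargeFieldI, (1.100) p.201 (bookkeeping)] -/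
theorem pinD189_D1100 : (lam.pinD189 θ σ).D1100 = lam.D1100 := rfl

/-- The pinned (1.89) letters at run `P` (`rfl`). [cite: Balaban1989LargeFieldI, (1.89) p.198 (bookkeeping)] -/
theorem pinD189_D189 (P : B12.RunParams) : (lam.pinD189 θ σ).D189 P = D189OfRecord θ P (σ P) := rfl

/-- **The two pins commute** (`rfl`): module 2's (1.100) pin touches `D1100` only, this pin touches `P₀ ∕ Cfg ∕ ι ∕ D189` only. [cite: Balaban1989LargeFieldI, (1.89) p.198, (1.100) p.201 (bookkeeping)] -/
theorem pinD189_pinRPrime_comm : (lam.pinD189 θ σ).pinRPrime θ = (lam.pinRPrime θ).pinD189 θ σ := rfl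

/-- At the doubly pinned layer the (1.89) letters are `D189OfRecord` (`rfl`). [cite: Balaban1989LargeFieldI, (1.89) p.198 (bookkeeping)] -/
theorem pinRPrime_pinD189_D189 (P : B12.RunParams) : ((lam.pinD189 θ σ).pinRPrime θ).D189 P = D189OfRecord θ P (σ P) := rfl

variable (F N) in
/-- **A2 — doubly pinned layers EXIST** for every parameter and situation family. [cite: Balaban1989LargeFieldI, (1.89) p.198, (1.100) p.201 (bookkeeping witness)] -/
theorem exists_residW_pinD189_pinRPrime (θ : Stage9Params F N) (σ : ∀ P : B12.RunParams, Sit189 F N P.K) :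
    ∃ lam : ResidW F N, (lam.pinD189 θ σ).pinRPrime θ = lam :=
  let ⟨lam₀⟩ := nonempty_residW F N
  ⟨(lam₀.pinD189 θ σ).pinRPrime θ, rfl⟩

end Pin

/-! ## §3. r11's junctions AT THE PIN: the remaining functions and the dropped `χ″_k` are concrete functions of def-R's background of record -/

section Junctions

variable (θ : Stage9Params F N) (P : B12.RunParams) (σ : Sit189 F N P.K)

/-- **THE REMAINING FUNCTIONS OF (1.89) AT THE PIN ARE r11's CONCRETE ONES at def-R's background of record** (`σ.h ≤ σ.k`): [III] (2.17) `χ_k(Ω_k^{∼4}) = 1`, (1.75) `χ_{k,Λ}`,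
(1.88) `χ_{h,1/2} = 1` and the (1.82) letter — r11's `new189_iff` by name. [cite: Balaban1989LargeFieldI, (1.89) p.198, (1.75) p.193, (1.88) p.198; Balaban1988Convergent, (2.17) p.257] -/
theorem new189_D189OfRecord_iff (hhk : σ.h ≤ σ.k) (U : MSField (F.P P.K) (SU N) × ((j : ℕ) → VecField (F.P P.K) j σ.𝔤)) :
    new189 (D189OfRecord θ P σ) U ↔
      chi217 (bgOfRecord (avOfRecord F N P.K) {U | PlaqSmall (θ.ν.εreg * (F.P P.K).eta σ.k ^ 2) U}) θ.ν.M₁ σ.XΩ4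
          (fun a => plaqInside (cubeEnl (F.P P.K) σ.sk a 1)) (fun a => cubeEnl (F.P P.K) σ.sk a 4) (epsOfRecord θ.ν (gOfRecord₁₀ F N θ P) σ.k) σ.k (U.1 σ.k) = 1 ∧
      chi175std (bgOfRecord (avOfRecord F N P.K) {U | PlaqSmall (θ.ν.εreg * (F.P P.K).eta σ.k ^ 2) U}) θ.ν.M₁ σ.Z σ.Λ σ.k σ.Ω
          (epsOfRecord θ.ν (gOfRecord₁₀ F N θ P) σ.k) ((F.P P.K).eta σ.k) (U.1 σ.k) ∧
      chiHalf (bgOfRecord (avOfRecord F N P.K) {U | PlaqSmall (θ.ν.εreg * (F.P P.K).eta σ.k ^ 2) U}) θ.ν.M₁ σ.Xhalf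
          (fun a => plaqInside (cubeEnl (F.P P.K) σ.sh a 1)) (fun a => cubeEnl (F.P P.K) σ.sh a 4) (epsOfRecord θ.ν (gOfRecord₁₀ F N θ P)) σ.h σ.ΩppT2 (U.1 σ.h) = 1 ∧
      σ.chiP U.2 :=
  B15Claim189AtInstances.new189_iff _ _ _ _ _ _ _ _ _ _ _ _ _ _ _ _ _ _ _ _ _ _ _ _ _ _ _ _ _ _ _ _ _ hhk U

/-- **The «immediate» deleted function `χ_h(Ω_h∩Z_h)` at the pin IS r11's concrete (1.3) function `chi13 … = 1`** (`σ.h ≤ σ.k`; r11's `chiH_iff`). [cite: Balaban1989LargeFieldI, (1.89) p.198, (1.3) p.178] -/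
theorem chiH_D189OfRecord_iff (hhk : σ.h ≤ σ.k) (U : MSField (F.P P.K) (SU N) × ((j : ℕ) → VecField (F.P P.K) j σ.𝔤)) :
    chiH (D189OfRecord θ P σ) U ↔
      chi13 (bgOfRecord (avOfRecord F N P.K) {U | PlaqSmall (θ.ν.εreg * (F.P P.K).eta σ.k ^ 2) U}) θ.ν.M₁ σ.XH
        (fun a => plaqInside (cubeEnl (F.P P.K) σ.sh a 1)) (fun a => cubeEnl (F.P P.K) σ.sh a 4) (epsOfRecord θ.ν (gOfRecord₁₀ F N θ P)) σ.h U.1 = 1 :=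
  B15Claim189AtInstances.chiH_iff _ _ _ _ _ _ _ _ _ _ _ _ _ _ _ _ _ _ _ _ _ _ _ _ _ _ _ _ _ _ _ _ _ hhk U

/-- **THE DROPPED `χ″_k` AT THE PIN IS r11's CONCRETE (1.24) FUNCTION of `U″_{k,Z}(V)` built from def-R's background of record** (`σ.h ≤ σ.k`; r11's `chiPP_iff`): the conclusion
of (1.89) speaks of objects of record. [cite: Balaban1989LargeFieldI, (1.89) p.198, (1.21) p.181, (1.24) pp.181–182; Balaban1988Convergent, (2.12) p.256] -/
theorem chiPP_D189OfRecord_iff (hhk : σ.h ≤ σ.k) (U : MSField (F.P P.K) (SU N) × ((j : ℕ) → VecField (F.P P.K) j σ.𝔤)) :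
    chiPP (D189OfRecord θ P σ) U ↔
      chi124std (bgOfRecord (avOfRecord F N P.K) {U | PlaqSmall (θ.ν.εreg * (F.P P.K).eta σ.k ^ 2) U}) θ.ν.M₁ σ.Ω σ.Zpp σ.Z σ.h σ.k σ.k₀ (σ.k - σ.h) σ.β σ.L₀
        (epsOfRecord θ.ν (gOfRecord₁₀ F N θ P)) ((F.P P.K).L : ℝ) ((F.P P.K).eta σ.k) U.1 :=
  B15Claim189AtInstances.chiPP_iff _ _ _ _ _ _ _ _ _ _ _ _ _ _ _ _ _ _ _ _ _ _ _ _ _ _ _ _ _ _ _ _ _ hhk U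

/-- **(1.89) AT THE RECORD'S OBJECTS** (r11's `eq189_at_instances` at the pin): from `Claim189` at the pinned letters, for a pair `(V, B′)` with the four CONCRETE remaining
functions, r11's concrete `χ″_k = χ_k^{(k−h)}` HOLDS at `V` for def-R's background of record. [cite: Balaban1989LargeFieldI, (1.89) p.198, pp.199–200] -/
theorem eq189_D189OfRecord (hhk : σ.h ≤ σ.k) (h189 : Claim189 (new189 (D189OfRecord θ P σ)) (chiPP (D189OfRecord θ P σ)))
    (V : MSField (F.P P.K) (SU N)) (B' : (j : ℕ) → VecField (F.P P.K) j σ.𝔤)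
    (hΩ4 : chi217 (bgOfRecord (avOfRecord F N P.K) {U | PlaqSmall (θ.ν.εreg * (F.P P.K).eta σ.k ^ 2) U}) θ.ν.M₁ σ.XΩ4
      (fun a => plaqInside (cubeEnl (F.P P.K) σ.sk a 1)) (fun a => cubeEnl (F.P P.K) σ.sk a 4) (epsOfRecord θ.ν (gOfRecord₁₀ F N θ P) σ.k) σ.k (V σ.k) = 1)
    (hΛ : chi175std (bgOfRecord (avOfRecord F N P.K) {U | PlaqSmall (θ.ν.εreg * (F.P P.K).eta σ.k ^ 2) U}) θ.ν.M₁ σ.Z σ.Λ σ.k σ.Ω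
      (epsOfRecord θ.ν (gOfRecord₁₀ F N θ P) σ.k) ((F.P P.K).eta σ.k) (V σ.k))
    (hhalf : chiHalf (bgOfRecord (avOfRecord F N P.K) {U | PlaqSmall (θ.ν.εreg * (F.P P.K).eta σ.k ^ 2) U}) θ.ν.M₁ σ.Xhalf
      (fun a => plaqInside (cubeEnl (F.P P.K) σ.sh a 1)) (fun a => cubeEnl (F.P P.K) σ.sh a 4) (epsOfRecord θ.ν (gOfRecord₁₀ F N θ P)) σ.h σ.ΩppT2 (V σ.h) = 1)
    (hchi' : σ.chiP B') :
    chi124std (bgOfRecord (avOfRecord F N P.K) {U | PlaqSmall (θ.ν.εreg * (F.P P.K).eta σ.k ^ 2) U}) θ.ν.M₁ σ.Ω σ.Zpp σ.Z σ.h σ.k σ.k₀ (σ.k - σ.h) σ.β σ.L₀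
      (epsOfRecord θ.ν (gOfRecord₁₀ F N θ P)) ((F.P P.K).L : ℝ) ((F.P P.K).eta σ.k) V :=
  B15Claim189AtInstances.eq189_at_instances _ _ _ _ _ _ _ _ _ _ _ _ _ _ _ _ _ _ _ _ _ _ _ _ _ _ _ _ _ _ _ _ _ hhk h189 V B' hΩ4 hΛ hhalf hchi'

end Junctions

/-! ## §4. (1.89) at the pin from its printed leaves, and the [IV] displays at a layer with BOTH pins -/

section Displays

variable {θ : Stage9Params F N} {lam : ResidW F N}

/-- **THE [IV] DISPLAYS AT A LAYER WITH PINNED (1.89) LETTERS AND PINNED (1.100) DATA** — module 2's `wDisplays₁₀_of_rPrimePin_leaves189` read at `λ.pinD189 θ σ`: `Provisos₁₀`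
+ `kSel P < P.K` + the (1.100) pin equation + positive mass + Proposition 1 (1.78) on `λ.LF P` + (1.80) on the ℍ-domains (at the letter `σ.dev0`) + (1.89)'s located inputs AT
THE RECORD'S OBJECTS: the numerics of `σ P` with the torus's `L` and `η_k` and the record's `ε_j`, the regions' nesting ∕ `j = k` ∕ shell geometry ∕ choice of `M`, the [III] (2.8)
flow relation FOR THE RECORD's `ε_j`, the (1.88) cover, and the leaves `L91h ∕ L95 ∕ L91 ∕ L97` whose backgrounds are def-R's (`bgPPZstd (bgOfRecord …)`, `ukBox (bgOfRecord …)`).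
[cite: Balaban1989LargeFieldI, (1.89) p.198, pp.199–200, (1.80) p.195, Prop. 1 (1.78) p.194, (0.2)–(0.4) p.176, (1.99)–(1.102) pp.200–201] -/
theorem wDisplays₁₀_pinD189_of_rPrimePin_leaves (hP : θ.Provisos₁₀) (σ : ∀ P : B12.RunParams, Sit189 F N P.K) {P : B12.RunParams} (hk : lam.kSel P < P.K)
    (hpin : lam.D1100 P
      = rPrimeDataOfSel (repTOfRecord9 F N θ.ν θ.τ9 (EOfRecord₁₀ F N θ) (wOfRecord₉ F N θ) θ.ppSel P (gOfRecord₁₀ F N θ P) (lam.kSel P))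
          (θ.ppSel P (gOfRecord₁₀ F N θ P) (lam.kSel P + 1)) (fibOfSeq F θ.ν θ.τ9 P (gOfRecord₁₀ F N θ P) (lam.kSel P + 1)))
    (hmass : ∀ s, 0 < ∫ V, rterm (repTOfRecord9 F N θ.ν θ.τ9 (EOfRecord₁₀ F N θ) (wOfRecord₉ F N θ) θ.ppSel P (gOfRecord₁₀ F N θ P) (lam.kSel P)) s V
      ∂(fieldMeasure (F.P P.K) (lam.kSel P + 1) (SU N)))
    (hP1 : Prop1Printed (lam.LF P))
    (h180 : ∀ U, new189 (D189OfRecord θ P (σ P)) U → ∀ i, (σ P).h ≤ i → i ≤ (σ P).k → ∀ q ∈ plaqsOf (dom (D189OfRecord θ P (σ P)) i),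
      Ineq180 ((σ P).dev0 U.1 q) (epsOfRecord θ.ν (gOfRecord₁₀ F N θ P) (σ P).k) ((F.P P.K).eta (σ P).k) (σ P).B₃ (σ P).B₅ (σ P).M (σ P).δ ((σ P).dist q) (σ P).O1)
    (hhk : (σ P).h ≤ (σ P).k₀) (hk₀ : (σ P).k₀ + 2 ≤ (σ P).k)
    (hΩ : ∀ i, (σ P).Ω (i + 1) ⊆ (σ P).Ω i) (hΩtop : (σ P).Ω (σ P).k ⊆ (σ P).Ω ((σ P).k + 1))
    (hα : (σ P).α = 1 / 12) (hβ0 : 0 ≤ (σ P).β) (hβ : (σ P).β ≤ 1 / 4) (hL₀ : 2 ≤ (σ P).L₀) (hL₀L : (σ P).L₀ ^ 2 ≤ ((F.P P.K).L : ℝ))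
    (hε0 : ∀ i, 0 ≤ epsOfRecord θ.ν (gOfRecord₁₀ F N θ P) i) (hε1 : ∀ i, epsOfRecord θ.ν (gOfRecord₁₀ F N θ P) i ≤ 1 / 10)
    (hB : 0 ≤ (σ P).O1 * (σ P).B₃ * (σ P).B₅ * (σ P).M ^ 5) (hδ : 0 ≤ (σ P).δ) (hM : 0 ≤ (σ P).M) (hdist : ∀ p, 0 ≤ (σ P).dist p)
    {X' : ℝ} (hX' : ∀ j, 2 + X (D189OfRecord θ P (σ P)) j ≤ X') (hsmall : X' * (((σ P).L₀ ^ 2) ^ ((σ P).k - (σ P).k₀ - 1))⁻¹ ≤ 1 / 4)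
    (hjEqK : ∀ m, (σ P).k₀ < m → m < (σ P).k → (σ P).Ω m \ (σ P).Ω (m + 1) ⊆ domK (D189OfRecord θ P (σ P)))
    (hgeom : ∀ m, (σ P).k₀ < m → m < (σ P).k → ∀ p ∈ plaqsOf ((σ P).Ω m \ (σ P).Ω (m + 1)), 4 * ((m : ℝ) - (σ P).k₀) * (σ P).M ≤ (σ P).dist p)
    (hlarge : X (D189OfRecord θ P (σ P)) (σ P).k * Real.exp (-(4 * (σ P).δ * (σ P).M)) ≤ (σ P).α)
    {β₀ : ℝ} (hβ₀0 : 0 ≤ β₀) (hβ₀ : β₀ ≤ 1 / 2)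
    (hflow : ∀ j, (σ P).h ≤ j → j < (σ P).k →
      epsOfRecord θ.ν (gOfRecord₁₀ F N θ P) (σ P).k ≤ (1 + β₀) * Real.sqrt (((σ P).k - j : ℕ) : ℝ) * epsOfRecord θ.ν (gOfRecord₁₀ F N θ P) j)
    (hbox : ∀ p ∈ plaqsOf (half (D189OfRecord θ P (σ P))), (σ P).boxOf p ∈ (↑(σ P).Xhalf : Set _) ∧ p ∈ plaqInside (cubeEnl (F.P P.K) (σ P).sh ((σ P).boxOf p) 1))
    (L91h : ∀ U, new189 (D189OfRecord θ P (σ P)) U → ∀ p ∈ plaqsOf (half (D189OfRecord θ P (σ P))),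
      Ineq191 (dist1 (plaqHol ((D189OfRecord θ P (σ P)).Upp U) p)) ((σ P).devV'' U.1 p) (σ P).α ((((F.P P.K).L : ℝ) ^ (σ P).h)⁻¹)
        (epsOfRecord θ.ν (gOfRecord₁₀ F N θ P) (σ P).h) (E124 (epsOfRecord θ.ν (gOfRecord₁₀ F N θ P)) ((F.P P.K).L : ℝ) ((F.P P.K).eta (σ P).k) (σ P).k (σ P).h))
    (L95 : ∀ U, new189 (D189OfRecord θ P (σ P)) U → ∀ p ∈ plaqsOf (half (D189OfRecord θ P (σ P))),
      Ineq195 ((σ P).devV'' U.1 p) (dist1 (plaqHol ((D189OfRecord θ P (σ P)).Uhalf U ((σ P).boxOf p)) p)) (σ P).α ((((F.P P.K).L : ℝ) ^ (σ P).h)⁻¹)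
        (epsOfRecord θ.ν (gOfRecord₁₀ F N θ P) (σ P).h) (E124 (epsOfRecord θ.ν (gOfRecord₁₀ F N θ P)) ((F.P P.K).L : ℝ) ((F.P P.K).eta (σ P).k) (σ P).k (σ P).h))
    (L91 : ∀ U, new189 (D189OfRecord θ P (σ P)) U → ∀ j, (σ P).h ≤ j → j ≤ (σ P).k → ∀ p ∈ plaqsOf (dom (D189OfRecord θ P (σ P)) j),
      Ineq191 (dist1 (plaqHol ((D189OfRecord θ P (σ P)).Upp U) p)) ((σ P).dev97 U.1 p) (σ P).α ((((F.P P.K).L : ℝ) ^ j)⁻¹)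
        (epsOfRecord θ.ν (gOfRecord₁₀ F N θ P) j) (E124 (epsOfRecord θ.ν (gOfRecord₁₀ F N θ P)) ((F.P P.K).L : ℝ) ((F.P P.K).eta (σ P).k) (σ P).k j))
    (L97 : ∀ U, new189 (D189OfRecord θ P (σ P)) U → ∀ j, (σ P).h ≤ j → j ≤ (σ P).k → ∀ p ∈ plaqsOf (dom (D189OfRecord θ P (σ P)) j),
      Ineq191 ((σ P).dev97 U.1 p) ((σ P).dev0 U.1 p) (σ P).α ((((F.P P.K).L : ℝ) ^ j)⁻¹) (epsOfRecord θ.ν (gOfRecord₁₀ F N θ P) j)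
        (E124 (epsOfRecord θ.ν (gOfRecord₁₀ F N θ P)) ((F.P P.K).L : ℝ) ((F.P P.K).eta (σ P).k) (σ P).k j)) :
    WDisplays₁₀ θ (lam.pinD189 θ σ) P :=
  wDisplays₁₀_of_rPrimePin_leaves189 (lam := lam.pinD189 θ σ) hP hk hpin hmass hP1 h180 hhk hk₀ hΩ hΩtop hα hβ0 hβ hL₀ hL₀L hε0 hε1 hB hδ hM hdist hX' hsmall
    hjEqK hgeom hlarge hβ₀0 hβ₀ hflow hbox L91h L95 L91 L97

/-- **(1.89) AT THE PIN AS ONE DISPLAY** (when the leaves are not unfolded): `Claim189` at `D189OfRecord θ P (σ P)` IS, by §3, the statement «the four concrete remaining functions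
at def-R's background ⇒ r11's concrete `χ″_k`» — recorded here as the `WDisplays₁₀` form with (1.89) displayed and (1.100) pinned (module 2's `wDisplays₁₀_of_rPrimePin` at the
D189-pinned layer). [cite: Balaban1989LargeFieldI, (1.89) p.198, (1.80) p.195, Prop. 1 (1.78) p.194, (0.2)–(0.4) p.176, (1.99)–(1.102) pp.200–201] -/
theorem wDisplays₁₀_pinD189_of_rPrimePin (hP : θ.Provisos₁₀) (σ : ∀ P : B12.RunParams, Sit189 F N P.K) {P : B12.RunParams} (hk : lam.kSel P < P.K)
    (hpin : lam.D1100 P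
      = rPrimeDataOfSel (repTOfRecord9 F N θ.ν θ.τ9 (EOfRecord₁₀ F N θ) (wOfRecord₉ F N θ) θ.ppSel P (gOfRecord₁₀ F N θ P) (lam.kSel P))
          (θ.ppSel P (gOfRecord₁₀ F N θ P) (lam.kSel P + 1)) (fibOfSeq F θ.ν θ.τ9 P (gOfRecord₁₀ F N θ P) (lam.kSel P + 1)))
    (hmass : ∀ s, 0 < ∫ V, rterm (repTOfRecord9 F N θ.ν θ.τ9 (EOfRecord₁₀ F N θ) (wOfRecord₉ F N θ) θ.ppSel P (gOfRecord₁₀ F N θ P) (lam.kSel P)) s V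
      ∂(fieldMeasure (F.P P.K) (lam.kSel P + 1) (SU N)))
    (hP1 : Prop1Printed (lam.LF P))
    (h180 : ∀ U, new189 (D189OfRecord θ P (σ P)) U → ∀ i, (σ P).h ≤ i → i ≤ (σ P).k → ∀ q ∈ plaqsOf (dom (D189OfRecord θ P (σ P)) i),
      Ineq180 ((σ P).dev0 U.1 q) (epsOfRecord θ.ν (gOfRecord₁₀ F N θ P) (σ P).k) ((F.P P.K).eta (σ P).k) (σ P).B₃ (σ P).B₅ (σ P).M (σ P).δ ((σ P).dist q) (σ P).O1)
    (h189 : Claim189 (new189 (D189OfRecord θ P (σ P))) (chiPP (D189OfRecord θ P (σ P)))) : WDisplays₁₀ θ (lam.pinD189 θ σ) P :=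
  B15RPrime1100AtRecord.wDisplays₁₀_of_rPrimePin (lam := lam.pinD189 θ σ) hP hk hpin hmass hP1 h180 h189

end Displays

end B15Claim189PinAtRecord

end Literature.MathematicalPhysics.QuantumFieldTheory.Balaban1983to89

end
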